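import Literature.Computability.QuantumComplexity.CubicForrelationEstimatorMachine
import Literature.Computability.QuantumComplexity.QuadraticWalshGaussSum
import Literature.Computability.QuantumComplexity.ForrelationMemValue
import Literature.Computability.QuantumComplexity.SamplingChebyshev
import HarnessLib

/-!
# Cubic 2-fold Forrelation is in promise-`BPP`: the analysis of the estimator

Topic `Literature/Computability/QuantumComplexity`; closes the dequantization of CUBIC 2-fold
Forrelation (route `QuantumAdvantage/CubicForrelation`, item `CubicForrelationInPrBPP`):
**`cubicKForrelationProblem 2 ∈ PromiseBPP'`** (`cubicKForrelationProblem_two_mem_PromiseBPP'`).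

The machine is `CubicForrelationEstimatorMachine.lean` (`CubicDequant.accept`, its `P`-witness and
the reduction `cubic_two_mem_PromiseBPP'_of_bounds` to two acceptance bounds); the ingredients of the
bounds are `ForrelationDerivativeTables.lean` (`2^{3n} Φ² = Σ_{h,u} T_f(h,u) T_g(u,h)`, row masses),
`QuadraticFourierSamplerProofs.lean` (the sampler is exact) and `QuadraticWalshGaussSum.lean`
(`TOf = W`). This file supplies:

* generic tools: **Chebyshev over independent coin blocks** with an absolute second-moment bound
  (`card_deviation_mul_sq_le'`, a variant of `BravyiGosset.card_deviation_mul_sq_le`), and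
  **prefix events** (`cnt_prefix`: an event decided by the first `m` coins has the same probability
  at every length `≥ m`);
* the identification of the machine's round with the statistic `X(h,w) = T_g(u,h)/T_f(h,u)`,
  `u = u_{D_h f}(w)` (`roundY_eq`), of its coin slices with coin blocks (`blocksOf`), and the moments
  `Σ X = 4ⁿ Φ²`, `Σ X² ≤ 4ⁿ` (`sum_X_eq`, `sum_X_sq_le`);
* the guard on yes-instances (`n ≤ |x| + 1`, from `ForrMem.value_eq`: two idle wires force
  `|Φ| ≤ 1/2`), and the two `2/3` bounds (`accept_prob_yes`, `reject_prob_no`) with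
  `N = 128 > 1/(3 · 0.17²)` rounds.

## References

* S. Aaronson, A. Ambainis, *Forrelation*, SIAM J. Comput. 47 (2018), §1.1.3 (thresholds), §6
  (explicit instances; Thm 26: cubic phase polynomials). [AaronsonAmbainis2018]
* S. T. Flammia, Y.-K. Liu, *Direct fidelity estimation from few Pauli measurements*, PRL 106 (2011)
  230501 (importance sampling a fidelity in the Pauli basis; Chebyshev). [orientation]
* S. Arora, B. Barak, *Computational Complexity*, CUP 2009, §7.4.1, Lemma A.12 (Chebyshev),
  Def. 7.3. [AroraBarak2009]
* O. Goldreich, *On promise problems*, 2006, Def. 1.2. [Goldreich2006]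
-/

noncomputable section

namespace Literature.Computability.QuantumComplexity

namespace CubicDequant

open Finset Literature.Computability.Complexity Literature.Computability.Complexity.F2Elim QuadPolar CHHL2018 QuadSampler
open Literature.Computability.Complexity.LowDegree (xorVec xorVec_apply)
open Literature.Computability.Complexity.BLR (toZ toZ_xor)
open ForrCode DerivativeWalsh

variable {n : ℕ}

/-! ### Chebyshev over independent coin blocks (absolute second moment) -/

/-- **Chebyshev over independent blocks, counting form, with an absolute second-moment bound**: for a
one-block statistic `X` on `κ` coins with `Σ_β X(β) = 2^κ μ` and `Σ_β X(β)² ≤ 2^κ σ`, the sum over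
`L` independent blocks deviates from `Lμ` by `δ` or more on at most `L 2^{κL} σ/δ²` block tuples.
[cite: AroraBarak2009, Lemma A.12 and §7.4.1] -/
theorem card_deviation_mul_sq_le' {κ L : ℕ} (X : (Fin κ → Bool) → ℝ) (μ σ : ℝ)
    (hmean : ∑ β, X β = 2 ^ κ * μ) (hsq : ∑ β, X β ^ 2 ≤ 2 ^ κ * σ) (δ : ℝ) (hδ : 0 ≤ δ) :
    ((univ.filter fun ω : Fin L → (Fin κ → Bool) => δ ≤ |∑ i, X (ω i) - L * μ|).card : ℝ) * δ ^ 2 ≤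
      L * 2 ^ (κ * L) * σ := by
  classical
  set D : (Fin κ → Bool) → ℝ := fun β => X β - μ with hDdef
  have hD : ∑ β, D β = 0 := by
    simp only [hDdef, sum_sub_distrib, hmean, sum_const, card_univ, Fintype.card_fun, Fintype.card_bool, Fintype.card_fin,
      nsmul_eq_mul]
    push_cast; ring
  have hvar : ∑ β, D β ^ 2 ≤ 2 ^ κ * σ := by
    have hexp : ∑ β, D β ^ 2 = ∑ β, X β ^ 2 - 2 * μ * ∑ β, X β + 2 ^ κ * μ ^ 2 := by
      simp only [hDdef, sub_sq, sum_add_distrib, sum_sub_distrib, sum_const, card_univ, Fintype.card_fun, Fintype.card_bool,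
        Fintype.card_fin, nsmul_eq_mul, mul_sum]
      push_cast
      congr 1; congr 1
      exact sum_congr rfl fun β _ => by ring
    rw [hexp, hmean]; nlinarith [sq_nonneg μ, pow_pos (two_pos : (0:ℝ) < 2) κ]
  have hdev : ∀ ω : Fin L → (Fin κ → Bool), ∑ i, X (ω i) - L * μ = ∑ i, D (ω i) := by
    intro ω
    simp only [hDdef, sum_sub_distrib, sum_const, card_univ, Fintype.card_fin, nsmul_eq_mul]
  set S := univ.filter fun ω : Fin L → (Fin κ → Bool) => δ ≤ |∑ i, X (ω i) - L * μ| with hS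
  have h1 : (S.card : ℝ) * δ ^ 2 ≤ ∑ ω ∈ S, (∑ i, D (ω i)) ^ 2 := by
    rw [← nsmul_eq_mul, ← sum_const]
    refine sum_le_sum fun ω hω => ?_
    have h := (mem_filter.1 hω).2
    rw [hdev] at h
    calc δ ^ 2 ≤ |∑ i, D (ω i)| ^ 2 := pow_le_pow_left₀ hδ h 2
      _ = (∑ i, D (ω i)) ^ 2 := sq_abs _
  have h2 : ∑ ω ∈ S, (∑ i, D (ω i)) ^ 2 ≤ ∑ ω : Fin L → (Fin κ → Bool), (∑ i, D (ω i)) ^ 2 :=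
    sum_le_sum_of_subset_of_nonneg (filter_subset _ _) fun ω _ _ => sq_nonneg _
  refine h1.trans (h2.trans ?_)
  rw [BravyiGosset.sum_sq_sum_apply D hD, Fintype.card_fun, Fintype.card_bool, Fintype.card_fin]
  push_cast
  rcases Nat.eq_zero_or_pos L with hL0 | hLpos
  · subst hL0; simp
  · have hpow : ((2 : ℝ) ^ κ) ^ (L - 1) * 2 ^ κ = 2 ^ (κ * L) := by
      rw [← pow_succ, Nat.sub_add_cancel hLpos, ← pow_mul]
    have hσ : 0 ≤ 2 ^ κ * σ := le_trans (sum_nonneg fun β _ => sq_nonneg (D β)) hvar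
    calc (L : ℝ) * (2 ^ κ) ^ (L - 1) * ∑ b, D b ^ 2 ≤ L * (2 ^ κ) ^ (L - 1) * (2 ^ κ * σ) :=
          mul_le_mul_of_nonneg_left hvar (by positivity)
      _ = L * 2 ^ (κ * L) * σ := by rw [← hpow]; ring

/-! ### Events decided by a prefix of the coins -/

/-- **Prefix events.** If membership in `E` is decided by the first `m` coins
(`y ++ z ∈ E ↔ y ∈ E` for `|y| = m`), then `cnt (m + e) E = cnt m E · 2^e`. [folklore] -/
theorem cnt_prefix : ∀ (m e : ℕ) (E : Set (List Bool)),
    (∀ y z : List Bool, y.length = m → (y ++ z ∈ E ↔ y ∈ E)) → cnt (m + e) E = cnt m E * 2 ^ e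
  | 0, e, E, hE => by
    classical
    have key : ∀ z : List Bool, z ∈ E ↔ [] ∈ E := fun z => by simpa using hE [] z rfl
    rw [zero_add, cnt_zero]
    split_ifs with h
    · rw [one_mul]; exact cnt_eq_two_pow_of_forall fun z _ => (key z).2 h
    · rw [zero_mul]
      have := (cnt_pos_iff e E).not
      simp only [not_lt, Nat.le_zero] at this
      exact this.2 fun ⟨z, _, hz⟩ => h ((key z).1 hz)
  | m + 1, e, E, hE => by
    rw [show m + 1 + e = (m + e) + 1 by ring, cnt_succ, cnt_succ m E,
      cnt_prefix m e _ (fun y z hy => by simpa using hE (false :: y) z (by simp [hy])),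
      cnt_prefix m e _ (fun y z hy => by simpa using hE (true :: y) z (by simp [hy])), add_mul]

/-- Hence the probability does not depend on the number of extra coins. [folklore] -/
theorem uniformProb_prefix {m M : ℕ} (hmM : m ≤ M) (E : Set (List Bool))
    (hE : ∀ y z : List Bool, y.length = m → (y ++ z ∈ E ↔ y ∈ E)) : uniformProb M E = uniformProb m E := by
  obtain ⟨e, rfl⟩ := Nat.exists_eq_add_of_le hmM
  rw [uniformProb_eq_cnt_div, uniformProb_eq_cnt_div, cnt_prefix m e E hE, pow_add]
  push_cast
  field_simp

/-! ### Signs -/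

/-- `signOf (a ⊕ b) = signOf a · signOf b`. [folklore] -/
theorem signOf_xor (a b : Bool) : signOf (a ^^ b) = signOf a * signOf b := by
  cases a <;> cases b <;> simp [signOf]

/-- `sgnZ ∘ toZFun = signOf`. [folklore] -/
theorem sgnZ_toZFun (f : (Fin n → Bool) → Bool) (x : Fin n → Bool) : sgnZ (toZFun f x) = signOf (f x) := by
  rw [toZFun_apply, signOf_eq_sgnZ]


/-! ### One coin block: `h`, `w`, the derivative, the statistic `X` -/

/-- The first half `h` of a block of `2n` coins. [folklore] -/
def hOf (β : Fin (2 * n) → Bool) : Fin n → Bool := fun i => β ⟨i, by omega⟩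

/-- The second half `w` of a block of `2n` coins. [folklore] -/
def wOf (β : Fin (2 * n) → Bool) : Fin n → Bool := fun i => β ⟨n + i, by omega⟩

/-- Gluing two halves. [folklore] -/
def glue (h w : Fin n → Bool) : Fin (2 * n) → Bool := fun i => if hi : (i : ℕ) < n then h ⟨i, hi⟩ else w ⟨i - n, by omega⟩

/-- **Blocks of `2n` coins are pairs `(h, w)`.** [folklore] -/
def splitEquiv : (Fin (2 * n) → Bool) ≃ (Fin n → Bool) × (Fin n → Bool) where
  toFun β := (hOf β, wOf β)
  invFun p := glue p.1 p.2
  left_inv β := by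
    funext i
    simp only [glue, hOf, wOf]
    split_ifs with hi
    · rfl
    · congr 1; exact Fin.ext (by simp; omega)
  right_inv p := by
    obtain ⟨h, w⟩ := p
    simp only [Prod.mk.injEq]
    constructor
    · funext i; simp [hOf, glue]
    · funext i; simp [wOf, glue]

/-- Sums over blocks are double sums over the halves. [folklore] -/
theorem sum_block_eq {M : Type*} [AddCommMonoid M] (G : (Fin n → Bool) → (Fin n → Bool) → M) :
    ∑ β : Fin (2 * n) → Bool, G (hOf β) (wOf β) = ∑ h, ∑ w, G h w := by
  rw [← Fintype.sum_prod_type']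
  exact Fintype.sum_equiv splitEquiv _ _ fun β => rfl

/-- The Boolean derivative `D_h f (x) = f(x) ⊕ f(x ⊕ h)` (the sampler's oracle `q`). [cite: AaronsonAmbainis2018, §6] -/
def Df (f : (Fin n → Bool) → Bool) (h : Fin n → Bool) : (Fin n → Bool) → Bool := fun x => (f x ^^ f (xorVec x h))

/-- **The Walsh transform of `(-1)^{D_h f}` is the derivative Walsh table**: `W_{D_h f}(u) = T_f(h,u)`.
[cite: AaronsonAmbainis2018, §1.1.1] -/
theorem walsh_Df (f : (Fin n → Bool) → Bool) (h u : Fin n → Bool) :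
    walsh (Df f h) u = dwt (fun x => signOf (f x)) h u := by
  unfold walsh dwt
  refine sum_congr rfl fun x _ => ?_
  rw [sgnZ_toZFun, Df, signOf_xor]
  rfl

/-- A cubic function has quadratic derivatives (`IsDegLeFun 3` form). [cite: Carlet2020, §2.2.2] -/
theorem Df_quadratic {f : (Fin n → Bool) → Bool} (hf : IsDegLeFun 3 f) (h : Fin n → Bool) : toZFun (Df f h) ∈ lowDeg n 2 := by
  obtain ⟨p, hp, hfp⟩ := hf
  exact der_toZFun_mem_lowDeg_two_of_cubic p hp hfp h

/-- The sampled frequency of a block: `u = uV (D_h f) w`. [folklore] -/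
def uB (f : (Fin n → Bool) → Bool) (h w : Fin n → Bool) : Fin n → Bool := uV (Df f h) w

/-- **The one-block statistic** `X(h,w) = T_g(u,h) / T_f(h,u)`, `u = uV (D_h f) w`. [cite: AaronsonAmbainis2018, §1.1.3] -/
def Xst (f g : (Fin n → Bool) → Bool) (h w : Fin n → Bool) : ℝ :=
  dwt (fun x => signOf (g x)) (uB f h w) h / dwt (fun x => signOf (f x)) h (uB f h w)

/-- `x² · (y / x) = x · y` (also for `x = 0`). [folklore] -/
theorem sq_mul_div_self (x y : ℝ) : x ^ 2 * (y / x) = x * y := by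
  by_cases hx : x = 0
  · simp [hx]
  · field_simp

/-- `x² · (y / x)² ≤ y²` (also for `x = 0`). [folklore] -/
theorem sq_mul_div_sq_le (x y : ℝ) : x ^ 2 * (y / x) ^ 2 ≤ y ^ 2 := by
  by_cases hx : x = 0
  · simp [hx]; positivity
  · rw [div_pow, mul_div_cancel₀ _ (pow_ne_zero 2 hx)]

/-- **First moment**: `Σ_{h,w} X(h,w) = 4ⁿ Φ(f,g)²` (the sampler is exact, then the dequantization
identity `Σ_{h,u} T_f(h,u) T_g(u,h) = 2^{3n} Φ²`). [cite: AaronsonAmbainis2018, §1.1.3] -/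
theorem sum_Xst_eq {f g : (Fin n → Bool) → Bool} (hf : IsDegLeFun 3 f) :
    ∑ h, ∑ w, Xst f g h w = (4 : ℝ) ^ n * forrelation f g ^ 2 := by
  have hrow : ∀ h : Fin n → Bool, (∑ w, Xst f g h w) * 2 ^ n =
      ∑ u, dwt (fun x => signOf (f x)) h u * dwt (fun x => signOf (g x)) u h := by
    intro h
    have key := sum_comp_uV_mul_two_pow (Df_quadratic hf h)
      (fun u => dwt (fun x => signOf (g x)) u h / dwt (fun x => signOf (f x)) h u)
    rw [show (fun w => Xst f g h w) = fun w => dwt (fun x => signOf (g x)) (uV (Df f h) w) h / dwt (fun x => signOf (f x)) h (uV (Df f h) w)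
      from rfl, key]
    refine sum_congr rfl fun u _ => ?_
    rw [walsh_Df, sq_mul_div_self]
  have htot : (∑ h, ∑ w, Xst f g h w) * 2 ^ n = (2 : ℝ) ^ (3 * n) * forrelation f g ^ 2 := by
    rw [sum_mul, sum_congr rfl fun h _ => hrow h, two_pow_mul_forrelation_sq]
  have h2 : (2 : ℝ) ^ (3 * n) = 4 ^ n * 2 ^ n := by
    rw [show (4 : ℝ) = 2 ^ 2 by norm_num, ← pow_mul, ← pow_add]; ring_nf
  have hpos : (0 : ℝ) < 2 ^ n := pow_pos two_pos n
  rw [h2] at htot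
  nlinarith [htot]

/-- **Second moment**: `Σ_{h,w} X(h,w)² ≤ 4ⁿ` (row masses `Σ_u T_g(u,h)²`, total `8ⁿ`).
[cite: AaronsonAmbainis2018, §1.1.3] -/
theorem sum_Xst_sq_le {f g : (Fin n → Bool) → Bool} (hf : IsDegLeFun 3 f) :
    ∑ h, ∑ w, Xst f g h w ^ 2 ≤ (4 : ℝ) ^ n := by
  have hrow : ∀ h : Fin n → Bool, (∑ w, Xst f g h w ^ 2) * 2 ^ n ≤ ∑ u, dwt (fun x => signOf (g x)) u h ^ 2 := by
    intro h
    have key := sum_comp_uV_mul_two_pow (Df_quadratic hf h)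
      (fun u => (dwt (fun x => signOf (g x)) u h / dwt (fun x => signOf (f x)) h u) ^ 2)
    rw [show (fun w => Xst f g h w ^ 2) = fun w => (dwt (fun x => signOf (g x)) (uV (Df f h) w) h / dwt (fun x => signOf (f x)) h (uV (Df f h) w)) ^ 2
      from rfl, key]
    refine sum_le_sum fun u _ => ?_
    rw [walsh_Df]
    exact sq_mul_div_sq_le _ _
  have htot : (∑ h, ∑ w, Xst f g h w ^ 2) * 2 ^ n ≤ (8 : ℝ) ^ n := by
    rw [sum_mul]
    refine (sum_le_sum fun h _ => hrow h).trans ?_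
    rw [sum_comm]
    exact (sum_sum_dwt_sq_of_sq (fun x => signOf (g x)) (fun x => BuzetChailloux.signOf_sq (g x))).le
  have h8 : (8 : ℝ) ^ n = 4 ^ n * 2 ^ n := by rw [← mul_pow]; norm_num
  have hpos : (0 : ℝ) < 2 ^ n := pow_pos two_pos n
  rw [h8] at htot
  exact le_of_mul_le_mul_right htot hpos

/-- The statistic on a block of `2n` coins. [folklore] -/
def Xblk (f g : (Fin n → Bool) → Bool) (β : Fin (2 * n) → Bool) : ℝ := Xst f g (hOf β) (wOf β)

/-- First moment in block form: `Σ_β X(β) = 2^{2n} Φ²`. [cite: AaronsonAmbainis2018, §1.1.3] -/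
theorem sum_Xblk_eq {f g : (Fin n → Bool) → Bool} (hf : IsDegLeFun 3 f) :
    ∑ β, Xblk f g β = (2 : ℝ) ^ (2 * n) * forrelation f g ^ 2 := by
  rw [show (fun β => Xblk f g β) = fun β => Xst f g (hOf β) (wOf β) from rfl, sum_block_eq, sum_Xst_eq hf, pow_mul]
  norm_num

/-- Second moment in block form: `Σ_β X(β)² ≤ 2^{2n} · 1`. [cite: AaronsonAmbainis2018, §1.1.3] -/
theorem sum_Xblk_sq_le {f g : (Fin n → Bool) → Bool} (hf : IsDegLeFun 3 f) :
    ∑ β, Xblk f g β ^ 2 ≤ (2 : ℝ) ^ (2 * n) * 1 := by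
  rw [show (fun β => Xblk f g β ^ 2) = fun β => Xst f g (hOf β) (wOf β) ^ 2 from rfl,
    sum_block_eq (fun h w => Xst f g h w ^ 2), mul_one, pow_mul]
  norm_num
  exact sum_Xst_sq_le hf

/-! ### Integrality: `T_f(h,u)` divides `8ⁿ` on the support -/

/-- The radical has a power-of-two size (it is a subspace of `𝔽₂ⁿ`). [folklore] -/
theorem card_rad_eq_two_pow {q : (Fin n → Bool) → Bool} (hq : toZFun q ∈ lowDeg n 2) : ∃ d, d ≤ n ∧ (rad q).card = 2 ^ d := by
  classical
  have hcard : (rad q).card = Fintype.card (LinearMap.ker (rowComb q)) := by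
    rw [← card_filter_rowComb_zero hq, Fintype.card_of_subtype (univ.filter fun v : Fin n → ZMod 2 => rowComb q v = 0)
      (fun v => by simp [LinearMap.mem_ker])]
  refine ⟨Module.finrank (ZMod 2) (LinearMap.ker (rowComb q)), ?_, ?_⟩
  · have := Submodule.finrank_le (LinearMap.ker (rowComb q))
    rwa [Module.finrank_fintype_fun_eq_card, Fintype.card_fin] at this
  · rw [hcard, Module.card_eq_pow_finrank (K := ZMod 2), ZMod.card]

/-- **On the support, `T_f(h,u)` is (up to sign) a power of two dividing `8ⁿ`.**
[cite: MacWilliamsSloane1977, Ch. 15 §2 Thm 5] -/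
theorem TOf_uOf_dvd {q : (Fin n → Bool) → Bool} (hq : toZFun q ∈ lowDeg n 2) (w : Fin n → Bool) :
    TOf (liftQ q) n (uOf (liftQ q) n (List.ofFn w)) ∣ (8 : ℤ) ^ n := by
  set T := TOf (liftQ q) n (uOf (liftQ q) n (List.ofFn w)) with hT
  obtain ⟨d, hdn, hd⟩ := card_rad_eq_two_pow hq
  -- `T² = 2^n · #fiber` and `#fiber = #rad = 2^d` (solvable fiber) since the fiber of `uV w` contains `w`
  have hreal : (T : ℝ) = walsh q (uV q w) := by rw [hT, uV]; exact TOf_eq_walsh hq (length_uOf _ _).le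
  have hsq : walsh q (uV q w) ^ 2 = 2 ^ n * 2 ^ d := by
    classical
    rw [walsh_sq_eq hq]
    have hsolv : ∀ d' ∈ rad q, dotZ (bz (uV q w) + bz (ustarV q)) (bz d') = 0 := by
      rw [← exists_rowComb_iff_orth hq]
      exact ⟨bz w, (uV_eq_iff w _).1 rfl⟩
    rw [if_pos hsolv, hd]; push_cast; ring
  have hnat : (T.natAbs : ℤ) ^ 2 = 2 ^ (n + d) := by
    have h1 : (T : ℝ) ^ 2 = 2 ^ (n + d) := by rw [hreal, hsq, pow_add]
    have h2 : ((T ^ 2 : ℤ) : ℝ) = ((2 ^ (n + d) : ℤ) : ℝ) := by push_cast; exact h1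
    have h3 : T ^ 2 = 2 ^ (n + d) := by exact_mod_cast h2
    rw [Int.natAbs_sq, h3]
  have hnat' : T.natAbs ^ 2 = 2 ^ (n + d) := by exact_mod_cast hnat
  have hdvd : T.natAbs ∣ 2 ^ (n + d) := ⟨T.natAbs, by rw [← hnat', sq]⟩
  obtain ⟨i, hi, hTi⟩ := (Nat.dvd_prime_pow Nat.prime_two).1 hdvd
  rw [← Int.natAbs_dvd, hTi]
  push_cast
  rw [show (8 : ℤ) = 2 ^ 3 by norm_num, ← pow_mul]
  exact pow_dvd_pow 2 (by omega)

/-! ### The machine's round is the statistic -/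

section Machine

variable (I : KForrelationInstance) (hk : I.k = 2)

/-- The first circuit. [folklore] -/
def C₀ : Circuit (Fin I.n) := I.C ⟨0, by omega⟩

/-- The second circuit. [folklore] -/
def C₁ : Circuit (Fin I.n) := I.C ⟨1, by omega⟩

/-- `f = C₀`, `g = C₁` as Boolean functions. [folklore] -/
def fI : (Fin I.n → Bool) → Bool := (C₀ I hk).eval

/-- `g = C₁`. [folklore] -/
def gI : (Fin I.n → Bool) → Bool := (C₁ I hk).eval

include hk in
/-- The value of a two-circuit instance is `Φ(f, g)`. [cite: AaronsonAmbainis2018, §1.1.1 and §6] -/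
theorem value_eq_forrelation_fg : I.value = forrelation (fI I hk) (gI I hk) := by
  rw [KForrelationInstance.value_eq_forrelation hk]
  rfl

/-- The machine's circuit `0` is `C₀`. [folklore] -/
theorem circAt_zero : circAt (instOf I) 0 = pcircOf (C₀ I hk) := circAt_instOf I ⟨0, by omega⟩

/-- The machine's circuit `1` is `C₁`. [folklore] -/
theorem circAt_one : circAt (instOf I) 1 = pcircOf (C₁ I hk) := circAt_instOf I ⟨1, by omega⟩

/-- **The machine's derivative oracle is the derivative**: `dq (code C) h = liftQ (D_{h} C)`. [folklore] -/
theorem dq_pcircOf (C : Circuit (Fin I.n)) (hL : List Bool) : dq (pcircOf C) hL = liftQ (Df C.eval (toInput I.n hL)) := by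
  funext v
  rw [dq, evalP_pcircOf_eq, evalP_pcircOf_eq, toInput_bxorL]
  rfl

/-- `coinVec` is a listed function. [folklore] -/
theorem coinVec_eq_ofFn (y : List Bool) (m off : ℕ) : coinVec y m off = List.ofFn fun i : Fin m => y.getD (off + i) false := by
  apply List.ext_getElem
  · simp [coinVec]
  · intro k h1 h2; simp [coinVec]

include hk in
/-- **One round of the machine is `8ⁿ · X(h, w)`** on its coin slices (`f = C₀` cubic so that the
sampler is exact and the Gauss sums are the derivative Walsh tables; `g = C₁` cubic likewise).
[cite: AaronsonAmbainis2018, §1.1.3] -/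
theorem roundY_eq (hf : IsDegLeFun 3 (fI I hk)) (hg : IsDegLeFun 3 (gI I hk)) (h w : Fin I.n → Bool) :
    (roundY I.n (pcircOf (C₀ I hk)) (pcircOf (C₁ I hk)) (List.ofFn h) (List.ofFn w) : ℝ) =
      (8 : ℝ) ^ I.n * Xst (fI I hk) (gI I hk) h w := by
  rw [roundY, dq_pcircOf, dq_pcircOf, toInput_ofFn]
  set q := Df (fI I hk) h with hq
  have hqf : Df (C₀ I hk).eval h = q := rfl
  rw [hqf]
  have hquad : toZFun q ∈ lowDeg I.n 2 := Df_quadratic hf h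
  set uL := uOf (liftQ q) I.n (List.ofFn w) with huL
  have hu : toInput I.n uL = uB (fI I hk) h w := rfl
  have hTf : (TOf (liftQ q) I.n uL : ℝ) = dwt (fun x => signOf (fI I hk x)) h (uB (fI I hk) h w) := by
    rw [TOf_eq_walsh hquad (length_uOf _ _).le, hu, hq, walsh_Df]
  have hg' : IsDegLeFun 3 (C₁ I hk).eval := hg
  have hTg : (TOf (liftQ (Df (C₁ I hk).eval (toInput I.n uL))) I.n (List.ofFn h) : ℝ) =
      dwt (fun x => signOf (gI I hk x)) (uB (fI I hk) h w) h := by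
    rw [TOf_eq_walsh (Df_quadratic hg' _) (by simp), toInput_ofFn, walsh_Df, hu]; rfl
  have hne : TOf (liftQ q) I.n uL ≠ 0 := TOf_uOf_ne_zero hquad w
  have hdvd : TOf (liftQ q) I.n uL ∣ (8 : ℤ) ^ I.n * TOf (liftQ (Df (C₁ I hk).eval (toInput I.n uL))) I.n (List.ofFn h) :=
    dvd_mul_of_dvd_left (TOf_uOf_dvd hquad w) _
  rw [Int.cast_div hdvd (by exact_mod_cast hne), Int.cast_mul, hTf, hTg, Xst]
  push_cast
  ring

/-- The coin slices of round `r` are the halves of block `r` (blocks of `2n` coins). [folklore] -/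
theorem coinVec_h (y : List Bool) (r : ℕ) : coinVec y I.n (2 * r * I.n) = List.ofFn (hOf (BravyiGosset.blocksOf (2 * I.n) y (r + 1) ⟨r, Nat.lt_succ_self r⟩)) := by
  rw [coinVec_eq_ofFn]
  congr 1; funext i
  simp only [hOf, BravyiGosset.blocksOf]
  congr 1; ring

/-- (second half). [folklore] -/
theorem coinVec_w (y : List Bool) (r : ℕ) : coinVec y I.n ((2 * r + 1) * I.n) = List.ofFn (wOf (BravyiGosset.blocksOf (2 * I.n) y (r + 1) ⟨r, Nat.lt_succ_self r⟩)) := by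
  rw [coinVec_eq_ofFn]
  congr 1; funext i
  simp only [wOf, BravyiGosset.blocksOf]
  congr 1; ring

/-- Block `r` of a longer tuple is block `r`. [folklore] -/
theorem blocksOf_restrict (y : List Bool) (κ : ℕ) {R r : ℕ} (hr : r < R) :
    BravyiGosset.blocksOf κ y (r + 1) ⟨r, Nat.lt_succ_self r⟩ = BravyiGosset.blocksOf κ y R ⟨r, hr⟩ := rfl

/-- A list sum over `List.range` is the `Fin` sum. [folklore] -/
theorem list_sum_map_range_eq {M : Type*} [AddCommMonoid M] (F : ℕ → M) (m : ℕ) :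
    ((List.range m).map F).sum = ∑ a : Fin m, F a := by
  rw [← Finset.sum_range]
  induction m with
  | zero => simp
  | succ m ih => rw [List.range_succ, List.map_append, List.sum_append, ih, Finset.sum_range_succ]; simp

include hk in
/-- **The machine's sum is `8ⁿ Σ_r X(block r)`.** [cite: AaronsonAmbainis2018, §1.1.3] -/
theorem sumY_eq (hf : IsDegLeFun 3 (fI I hk)) (hg : IsDegLeFun 3 (gI I hk)) (y : List Bool) :
    (sumY I.n (pcircOf (C₀ I hk)) (pcircOf (C₁ I hk)) y : ℝ) =
      (8 : ℝ) ^ I.n * ∑ r : Fin N, Xblk (fI I hk) (gI I hk) (BravyiGosset.blocksOf (2 * I.n) y N r) := by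
  rw [sumY, list_sum_map_range_eq, Int.cast_sum, mul_sum]
  refine sum_congr rfl fun r _ => ?_
  rw [roundAt, coinVec_h, coinVec_w, roundY_eq I hk hf hg]
  rfl

end Machine

/-! ### The acceptance event and the two bounds -/

section Bounds

open scoped Classical

variable (I : KForrelationInstance) (hk : I.k = 2)

/-- The threshold event on block tuples: `9 N ≤ 50 Σ_r X(ω_r)` (mean `≥ 0.18`). [folklore] -/
def Good (ω : Fin N → Fin (2 * I.n) → Bool) : Prop := 9 * (N : ℝ) ≤ 50 * ∑ r, Xblk (fI I hk) (gI I hk) (ω r)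

include hk in
/-- **The machine accepts iff the block tuple of the coins is good** (under the guard).
[cite: AaronsonAmbainis2018, §1.1.3] -/
theorem accept_iff (hf : IsDegLeFun 3 (fI I hk)) (hg : IsDegLeFun 3 (gI I hk)) {L : ℕ} (hn : I.n ≤ L + 1) (y : List Bool) :
    accept (instOf I) L y = true ↔ Good I hk (BravyiGosset.blocksOf (2 * I.n) y N) := by
  have hnEff : nEff (instOf I) L = I.n := min_eq_left hn
  rw [accept, Good]
  simp only [Bool.and_eq_true, decide_eq_true_eq]
  rw [show (instOf I).2.1 = I.k from rfl, hk, show (instOf I).1 = I.n from rfl, hnEff, circAt_zero I hk, circAt_one I hk]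
  simp only [true_and, hn]
  have cast_iff : (9 * (N : ℤ) * 8 ^ I.n ≤ 50 * sumY I.n (pcircOf (C₀ I hk)) (pcircOf (C₁ I hk)) y) ↔
      ((9 * (N : ℤ) * 8 ^ I.n : ℤ) : ℝ) ≤ ((50 * sumY I.n (pcircOf (C₀ I hk)) (pcircOf (C₁ I hk)) y : ℤ) : ℝ) := Int.cast_le.symm
  rw [cast_iff]
  push_cast
  rw [sumY_eq I hk hf hg]
  have hpos : (0 : ℝ) < 8 ^ I.n := pow_pos (by norm_num) _
  constructor
  · intro h; nlinarith
  · intro h; nlinarith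

/-- The machine reads only the first `2 N n` coins. [folklore] -/
theorem coinVec_append (y z : List Bool) {m off : ℕ} (h : off + m ≤ y.length) : coinVec (y ++ z) m off = coinVec y m off := by
  unfold coinVec
  refine List.map_congr_left fun i hi => ?_
  rw [List.mem_range] at hi
  rw [List.getD_append _ _ _ _ (by omega)]

/-- **Extra coins do not matter.** [folklore] -/
theorem accept_append {L : ℕ} (hn : I.n ≤ L + 1) (y z : List Bool) (hy : y.length = N * (2 * I.n)) :
    accept (instOf I) L (y ++ z) = accept (instOf I) L y := by
  have hnEff : nEff (instOf I) L = I.n := min_eq_left hn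
  have hsum : ∀ c₀ c₁ : PCirc, sumY I.n c₀ c₁ (y ++ z) = sumY I.n c₀ c₁ y := by
    intro c₀ c₁
    unfold sumY
    congr 1
    refine List.map_congr_left fun r hr => ?_
    rw [List.mem_range] at hr
    unfold roundAt
    rw [coinVec_append y z (by nlinarith), coinVec_append y z (by nlinarith)]
  unfold accept
  rw [hnEff, hsum]

include hk in
/-- **Yes-instances satisfy the guard**: two or more idle input wires give `|Φ| ≤ 1/2 < 3/5`, so
`Φ ≥ 3/5` forces `n ≤ #read wires + 1 ≤ |x| + 1`. [cite: AaronsonAmbainis2018, §3.2 and §6] -/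
theorem guard_of_isYes (hyes : I.IsYes) : I.n ≤ I.encode.length + 1 := by
  by_contra hlt
  push Not at hlt
  have hs := ForrMem.sR_le_length I
  have ht : 2 ≤ I.n - ForrMem.sR I := by omega
  have hval := ForrMem.value_eq I
  have hrho : idleFactor I.k = (Real.sqrt 2)⁻¹ := idleFactor_of_even (by rw [hk])
  have habs : |I.value| ≤ 1 / 2 := by
    rw [hval, abs_mul, abs_pow, hrho, abs_inv, abs_of_nonneg (Real.sqrt_nonneg 2)]
    have h1 : |ForrMem.phi0 I| ≤ 1 := abs_kForrelationValue_le_one _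
    have hr1 : (Real.sqrt 2)⁻¹ ≤ 1 := by
      rw [inv_le_one₀ (Real.sqrt_pos.2 two_pos)]
      exact Real.one_le_sqrt.2 (by norm_num)
    have hr0 : 0 ≤ (Real.sqrt 2)⁻¹ := by positivity
    have h2 : ((Real.sqrt 2)⁻¹) ^ (I.n - ForrMem.sR I) ≤ ((Real.sqrt 2)⁻¹) ^ 2 := pow_le_pow_of_le_one hr0 hr1 ht
    have hsq : ((Real.sqrt 2)⁻¹) ^ 2 = 1 / 2 := by rw [inv_pow, Real.sq_sqrt (by norm_num)]; norm_num
    calc |ForrMem.phi0 I| * (Real.sqrt 2)⁻¹ ^ (I.n - ForrMem.sR I) ≤ 1 * (1 / 2) := by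
          rw [← hsq]; exact mul_le_mul h1 h2 (by positivity) zero_le_one
      _ = 1 / 2 := one_mul _
  have := hyes.2
  have := le_abs_self I.value
  linarith

/-- `N · 0.17² · … `: the numerical heart, `3 ≤ 0.0289 · N` for `N = 128`. [folklore] -/
theorem N_large : (3 : ℝ) ≤ 0.0289 * N := by rw [N]; norm_num

/-- The coin polynomial `p(L) = 2 N (L + 1)`. [folklore] -/
def coinPoly : Polynomial ℕ := Polynomial.C (2 * N) * (Polynomial.X + 1)

/-- `p(L) = 2 N (L + 1)`. [folklore] -/
theorem coinPoly_eval (L : ℕ) : coinPoly.eval L = 2 * N * (L + 1) := by simp [coinPoly]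

include hk in
/-- **Chebyshev for the estimator**: the good tuples are at least `2/3` of all when `Φ ≥ 3/5`, and
the bad ones at least `2/3` when `|Φ| ≤ 1/100`. [cite: AroraBarak2009, Lemma A.12] -/
theorem card_deviates_le (hf : IsDegLeFun 3 (fI I hk)) :
    3 * ((univ.filter fun ω : Fin N → Fin (2 * I.n) → Bool =>
        0.17 * N ≤ |∑ i, Xblk (fI I hk) (gI I hk) (ω i) - N * forrelation (fI I hk) (gI I hk) ^ 2|).card : ℝ) ≤
      2 ^ (2 * I.n * N) := by
  have h := card_deviation_mul_sq_le' (L := N) (Xblk (fI I hk) (gI I hk)) (forrelation (fI I hk) (gI I hk) ^ 2) 1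
    (sum_Xblk_eq hf) (sum_Xblk_sq_le hf) (0.17 * N) (by rw [N]; norm_num)
  have hN : (0 : ℝ) < N := by rw [N]; norm_num
  have key : 3 * (N : ℝ) ≤ (0.17 * N) ^ 2 := by nlinarith [N_large]
  set c := ((univ.filter fun ω : Fin N → Fin (2 * I.n) → Bool =>
        0.17 * N ≤ |∑ i, Xblk (fI I hk) (gI I hk) (ω i) - N * forrelation (fI I hk) (gI I hk) ^ 2|).card : ℝ)
  have hc : 0 ≤ c := Nat.cast_nonneg _
  have hp : (0 : ℝ) ≤ 2 ^ (2 * I.n * N) := by positivity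
  nlinarith [h, key, mul_nonneg hc hp]

include hk in
/-- **Yes side**: `Φ ≥ 3/5` ⇒ at least `2/3` of the block tuples are good. [cite: AaronsonAmbainis2018, §1.1.3] -/
theorem good_yes (hf : IsDegLeFun 3 (fI I hk)) (hΦ : 3 / 5 ≤ forrelation (fI I hk) (gI I hk)) :
    2 * (2 : ℝ) ^ (2 * I.n * N) ≤ 3 * ((univ.filter fun ω : Fin N → Fin (2 * I.n) → Bool => Good I hk ω).card : ℝ) := by
  classical
  have hdev := card_deviates_le I hk hf
  set μ := forrelation (fI I hk) (gI I hk) ^ 2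
  have hμ : 0.36 ≤ μ := by nlinarith
  -- not good ⇒ deviates
  have hsub : (univ.filter fun ω : Fin N → Fin (2 * I.n) → Bool => ¬ Good I hk ω) ⊆
      univ.filter fun ω => 0.17 * N ≤ |∑ i, Xblk (fI I hk) (gI I hk) (ω i) - N * μ| := by
    intro ω hω
    rw [mem_filter] at hω ⊢
    refine ⟨mem_univ _, ?_⟩
    have hng : ¬ (9 * (N : ℝ) ≤ 50 * ∑ r, Xblk (fI I hk) (gI I hk) (ω r)) := hω.2
    push Not at hng
    have hN : (0 : ℝ) < N := by rw [N]; norm_num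
    rw [abs_sub_comm, abs_of_nonneg (by nlinarith)]
    nlinarith
  have hcard := card_le_card hsub
  have htot := Finset.card_filter_add_card_filter_not (s := (univ : Finset (Fin N → Fin (2 * I.n) → Bool))) (fun ω => Good I hk ω)
  rw [card_univ, Fintype.card_fun, Fintype.card_fin, Fintype.card_fun, Fintype.card_bool, Fintype.card_fin] at htot
  have htot' : (((univ.filter fun ω : Fin N → Fin (2 * I.n) → Bool => Good I hk ω).card : ℝ) +
      ((univ.filter fun ω : Fin N → Fin (2 * I.n) → Bool => ¬ Good I hk ω).card : ℝ)) = 2 ^ (2 * I.n * N) := by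
    rw [← pow_mul] at htot; exact_mod_cast htot
  have hcard' : ((univ.filter fun ω : Fin N → Fin (2 * I.n) → Bool => ¬ Good I hk ω).card : ℝ) ≤
      ((univ.filter fun ω : Fin N → Fin (2 * I.n) → Bool => 0.17 * N ≤ |∑ i, Xblk (fI I hk) (gI I hk) (ω i) - N * μ|).card : ℝ) := by
    exact_mod_cast hcard
  have hB : 3 * ((univ.filter fun ω : Fin N → Fin (2 * I.n) → Bool => ¬ Good I hk ω).card : ℝ) ≤ 2 ^ (2 * I.n * N) :=
    le_trans (mul_le_mul_of_nonneg_left hcard' (by norm_num)) hdev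
  linarith [htot', hB]

include hk in
/-- **No side**: `|Φ| ≤ 1/100` ⇒ at least `2/3` of the block tuples are not good. [cite: AaronsonAmbainis2018, §1.1.3] -/
theorem bad_no (hf : IsDegLeFun 3 (fI I hk)) (hΦ : |forrelation (fI I hk) (gI I hk)| ≤ 1 / 100) :
    2 * (2 : ℝ) ^ (2 * I.n * N) ≤ 3 * ((univ.filter fun ω : Fin N → Fin (2 * I.n) → Bool => ¬ Good I hk ω).card : ℝ) := by
  classical
  have hdev := card_deviates_le I hk hf
  set μ := forrelation (fI I hk) (gI I hk) ^ 2
  have hμ : μ ≤ 0.0001 := by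
    have := sq_abs (forrelation (fI I hk) (gI I hk))
    nlinarith [abs_nonneg (forrelation (fI I hk) (gI I hk))]
  have hμ0 : 0 ≤ μ := sq_nonneg _
  have hsub : (univ.filter fun ω : Fin N → Fin (2 * I.n) → Bool => Good I hk ω) ⊆
      univ.filter fun ω => 0.17 * N ≤ |∑ i, Xblk (fI I hk) (gI I hk) (ω i) - N * μ| := by
    intro ω hω
    rw [mem_filter] at hω ⊢
    refine ⟨mem_univ _, ?_⟩
    have hg : 9 * (N : ℝ) ≤ 50 * ∑ r, Xblk (fI I hk) (gI I hk) (ω r) := hω.2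
    have hN : (0 : ℝ) < N := by rw [N]; norm_num
    rw [abs_of_nonneg (by nlinarith)]
    nlinarith
  have hcard := card_le_card hsub
  have htot := Finset.card_filter_add_card_filter_not (s := (univ : Finset (Fin N → Fin (2 * I.n) → Bool))) (fun ω => Good I hk ω)
  rw [card_univ, Fintype.card_fun, Fintype.card_fin, Fintype.card_fun, Fintype.card_bool, Fintype.card_fin] at htot
  have htot' : (((univ.filter fun ω : Fin N → Fin (2 * I.n) → Bool => Good I hk ω).card : ℝ) +
      ((univ.filter fun ω : Fin N → Fin (2 * I.n) → Bool => ¬ Good I hk ω).card : ℝ)) = 2 ^ (2 * I.n * N) := by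
    rw [← pow_mul] at htot; exact_mod_cast htot
  have hcard' : ((univ.filter fun ω : Fin N → Fin (2 * I.n) → Bool => Good I hk ω).card : ℝ) ≤
      ((univ.filter fun ω : Fin N → Fin (2 * I.n) → Bool => 0.17 * N ≤ |∑ i, Xblk (fI I hk) (gI I hk) (ω i) - N * μ|).card : ℝ) := by
    exact_mod_cast hcard
  have hG : 3 * ((univ.filter fun ω : Fin N → Fin (2 * I.n) → Bool => Good I hk ω).card : ℝ) ≤ 2 ^ (2 * I.n * N) :=
    le_trans (mul_le_mul_of_nonneg_left hcard' (by norm_num)) hdev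
  linarith [htot', hG]

include hk in
/-- **From block tuples to coin strings**: the acceptance probability with `p(|x|)` coins is the
fraction of good block tuples. [folklore] -/
theorem uniformProb_accept_eq (hf : IsDegLeFun 3 (fI I hk)) (hg : IsDegLeFun 3 (gI I hk)) (hn : I.n ≤ I.encode.length + 1) (b : Bool) :
    uniformProb (coinPoly.eval I.encode.length) {y | accept (instOf I) I.encode.length y = b} =
      ((univ.filter fun ω : Fin N → Fin (2 * I.n) → Bool => decide (Good I hk ω) = b).card : ℝ) / 2 ^ (N * (2 * I.n)) := by
  classical
  have hm : N * (2 * I.n) ≤ coinPoly.eval I.encode.length := by rw [coinPoly_eval]; nlinarith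
  rw [uniformProb_prefix hm _ (fun y z hy => by
    simp only [Set.mem_setOf_eq]; rw [accept_append I hn y z hy])]
  rw [uniformProb_eq_cnt_div]
  congr 1
  have e1 : cnt (N * (2 * I.n)) {y | accept (instOf I) I.encode.length y = b} =
      cnt (N * (2 * I.n)) {y | decide (Good I hk (BravyiGosset.blocksOf (2 * I.n) y N)) = b} := by
    refine cnt_congr fun y _ => ?_
    simp only [Set.mem_setOf_eq]
    have := accept_iff I hk hf hg hn y
    cases hb : accept (instOf I) I.encode.length y
    · rw [hb] at this
      have hng : ¬ Good I hk (BravyiGosset.blocksOf (2 * I.n) y N) := fun hg' => by simpa using this.2 hg'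
      simp [hng]
    · rw [hb] at this
      simp [this.1 rfl]
  rw [e1, BravyiGosset.cnt_blocks (2 * I.n) N fun ω => decide (Good I hk ω) = b]

/-- Instances in the cubic promise problems: read back the data. [folklore] -/
theorem of_mem_yes {x : List Bool} (hx : x ∈ (cubicKForrelationProblem 2).yes) :
    ∃ I : KForrelationInstance, I.encode = x ∧ I.IsYes ∧ I.k = 2 ∧ ∀ i, IsDegLeFun 3 (I.C i).eval := by
  obtain ⟨I, ⟨h1, h2, -, h4⟩, rfl⟩ := hx
  exact ⟨I, rfl, h1, h2, h4⟩

/-- (no side). [folklore] -/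
theorem of_mem_no {x : List Bool} (hx : x ∈ (cubicKForrelationProblem 2).no) :
    ∃ I : KForrelationInstance, I.encode = x ∧ I.IsNo ∧ I.k = 2 ∧ ∀ i, IsDegLeFun 3 (I.C i).eval := by
  obtain ⟨I, ⟨h1, h2, -, h4⟩, rfl⟩ := hx
  exact ⟨I, rfl, h1, h2, h4⟩

end Bounds

/-- **Cubic 2-fold Forrelation is in promise-`BPP`** (`CubicForrelationInPrBPP`): on yes-instances
(`B₂`-circuits computing cubic functions, `Φ ≥ 3/5`) the estimator machine accepts at least `2/3` of
the coin strings of length `2 · 128 · (|x| + 1)`, on no-instances (`|Φ| ≤ 1/100`) it rejects at least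
`2/3` of them. [cite: AaronsonAmbainis2018, §1.1.3 and §6 (Thm 26)] -/
theorem cubicKForrelationProblem_two_mem_PromiseBPP' : cubicKForrelationProblem 2 ∈ PromiseBPP' := by
  classical
  refine cubic_two_mem_PromiseBPP'_of_bounds coinPoly (fun I hI => ?_) (fun I hI => ?_)
  · obtain ⟨I', hII', hyes, hk, hdeg⟩ := of_mem_yes hI
    obtain rfl : I' = I := KForrelationInstance.encode_injective hII'
    have hf : IsDegLeFun 3 (fI I' hk) := hdeg _
    have hg : IsDegLeFun 3 (gI I' hk) := hdeg _
    have hn := guard_of_isYes I' hk hyes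
    rw [uniformProb_accept_eq I' hk hf hg hn true, le_div_iff₀ (by positivity)]
    have hΦ : 3 / 5 ≤ forrelation (fI I' hk) (gI I' hk) := by rw [← value_eq_forrelation_fg I' hk]; exact hyes.2
    have := good_yes I' hk hf hΦ
    rw [mul_comm N (2 * I'.n)]
    have e : (univ.filter fun ω : Fin N → Fin (2 * I'.n) → Bool => decide (Good I' hk ω) = true) =
        univ.filter fun ω => Good I' hk ω := by ext ω; simp
    rw [e]
    linarith
  · obtain ⟨I', hII', hno, hk, hdeg⟩ := of_mem_no hI
    obtain rfl : I' = I := KForrelationInstance.encode_injective hII'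
    have hf : IsDegLeFun 3 (fI I' hk) := hdeg _
    have hg : IsDegLeFun 3 (gI I' hk) := hdeg _
    by_cases hn : I'.n ≤ I'.encode.length + 1
    · rw [uniformProb_accept_eq I' hk hf hg hn false, le_div_iff₀ (by positivity)]
      have hΦ : |forrelation (fI I' hk) (gI I' hk)| ≤ 1 / 100 := by rw [← value_eq_forrelation_fg I' hk]; exact hno.2
      have := bad_no I' hk hf hΦ
      rw [mul_comm N (2 * I'.n)]
      have e : (univ.filter fun ω : Fin N → Fin (2 * I'.n) → Bool => decide (Good I' hk ω) = false) =
          univ.filter fun ω => ¬ Good I' hk ω := by ext ω; simp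
      rw [e]
      linarith
    · -- guard fails: the machine rejects every coin string
      have hall : ∀ y : List Bool, accept (instOf I') I'.encode.length y = false := by
        intro y
        rw [accept, show (instOf I').1 = I'.n from rfl]
        simp [hn]
      have : uniformProb (coinPoly.eval I'.encode.length) {y | accept (instOf I') I'.encode.length y = false} = 1 := by
        rw [show {y : List Bool | accept (instOf I') I'.encode.length y = false} = Set.univ from Set.eq_univ_of_forall hall]
        exact uniformProb_univ _
      rw [this]; norm_num

end CubicDequant

end Literature.Computability.QuantumComplexity

end
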